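import Summits.QuantumFields.BalabanUV.T4Continuum.Support.NE7EtaSupFromEnergy
import Summits.QuantumFields.BalabanUV.T4Continuum.Support.NE3EnergySmallFieldCurl

/-!
# NE7EtaPlaquetteCloseness — route #1 of the NE7 crux, hardest stub S1∕L7b: the PLAQUETTE VARIABLES of the two runs' backgrounds
# (run A's gauge-fixed minimiser `W e^Z`, the once-averaged run-B minimiser `W`) are pointwise close, from row NE3's ENERGY
# conjunct + step-Lipschitz conjuncts + the sup conjunct (for the exponential factor only) — cube side free

Cell `pub-balaban`, rung (B)+1 sub-cell t4, lineage `b2b-balaban-t4-ne7-p1`, generation 21 (CRUX PROVER NE7 #1, ruling e34b3e0c);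
crux skeleton `t4/skeletons/NE7-CRUX-R1.md` v1.5 rows S1∕S2 and §3bis; sequel of `Support/NE7EtaSupFromEnergy` (p249485).
HONEST FRAMING (page 1): FIXED FINITE T⁴, rung (B)+1; NE7, NE3 NOT PRINTED in [Balaban1984PropagatorsI]–[Balaban1989LargeFieldII]
and NOT PROVED here; continuum YM on T⁴ ⇐ BetaPertH ∧ nine spine estimates (0/9 proved); BetaPertH ⇐ (D1) ∧ (D4) ∧ CAP+tail;
G-an2-4 gates asym, D1 and NE2/3/4; NOT infinite volume, NOT mass gap, NOT Clay.

WHAT.  The U-slot of route #1 reads the backgrounds through the printed spaces (1.11)–(1.16) p. 262 of [Balaban1987RG1], whose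
condition (iv)∕(1.15) is on PLAQUETTE variables (`|∂U − 1| < α₀ξ²`).  So the two-run closeness that matters is
`‖(W e^Z)(∂p) − W(∂p)‖` against `βα₀(g_k)ξ²`.  Row NE3's formalisation crew already proved the one-configuration calculus
`NE3EnergySmallFieldCurl.norm_hol_vary_sub_hol_le_curl`: for unitary `W`, skew `Z` with `‖Z(b)‖ ≤ α`,
`‖(W e^{Z})(∂p) − W(∂p)‖ ≤ ‖(d_W Z)(p)‖ + 6(e^α − 1)·Σ_{b∈∂p}‖Z(b)‖` (first order = the dressed curl; second order through the
sup).  THIS FILE composes it with the two pointwise bounds of `NE7EtaSupFromEnergy` (ℓ²(energy) + step-Lipschitz ⇒ pointwise on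
cubes):
 * §1 `norm_fhol_vary_sub_le_of_energyNormW` — for unitary `W`, skew `Z` with global sup `α`, step-Lipschitz constants `λ` (of every
   `Z(·, κ)`) and `λ′` (of `(d_W Z)(·, π)`), and a cube `Icc y₀ (y₀ + r) ⊆ F` containing the three sites `z, z + e_μ, z + e_ν` of the
   plaquette `p = (z; μ < ν)`:
   `‖(W e^Z)(∂p) − W(∂p)‖ ≤ [2d·r·λ′ + E∕√((r+1)^d)] + 6(e^α − 1)·4·[2d·r·λ + L^k·E∕√((r+1)^d)]`, `E = energyNormW L k W Z F`;
 * §2 `plaquette_closeness_of_ne3EnergyRateWSup` — BY NAME through row NE3's root T-E_w♯ (`NE3EnergyRateWSup`): for the minimiser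
   pair the root represents as `gaugeAct u UA = vary W Z 1`, `W = rescale L (bavg L UB)`, with `E ≤ C·residualScale d L N b g k` and
   `α = s·(L⁻¹)^k` (the root's own sup conjunct, used ONLY in the exponential factor), the same display with `E` replaced by
   `C·residualScale` — for every cube inside the period box and every step-Lipschitz constants the pair's `Z` happens to have.
EXPONENT COUNT (prose; d = 4, ξ = L^{−k}, as in `NE7EtaSupFromEnergy`): first bracket `≲ ξ^{2+1/3}` (λ′ = Λ₂ξ³, optimised r),
second term `≲ 24·sξ·ξ^{4/3} = 24s·ξ^{7/3}` (λ = Λ₁ξ²) — both ONE THIRD of a power below the margin `βα₀(g_k)ξ²` up to the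
poly∕log loss of `α₀(g_k)`: rate `L^{−1/3}` per step, tolerated by `T4TowerRateDischarge` §3.  The sup conjunct ALONE would give
`4sξ + 24s²ξ²e^{sξ}` — NOT below the margin (the currency census of skeleton v1.5, GAPS A-ne7p1g21-1).
HONEST.  Unitarity of `W` is a displayed hypothesis (one-run: `MinimalActionLevels.isUnitaryCfg_rescale_bavg` under `Regular`'s
small-field data); the Lipschitz constants are displayed hypotheses NOT supplied by T-E_w♯ (the re-typed INTERFACE REQUEST NE7→NE3
of skeleton v1.5 §4 asks for them inside the root's ∃); the choice of cubes inside the period box and the optimisation of `r` are the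
consumer's; NODE O's carrier is untouched; nothing of NE3∕NE7 is discharged.  [folklore] composition; 0 def; 0 sorry; nothing printed
is a hypothesis of a theorem.
-/

set_option autoImplicit false

open scoped BigOperators Matrix Matrix.Norms.L2Operator
open Finset

namespace Summit.QuantumFields.BalabanUV.T4Continuum.NE7EtaPlaquetteCloseness

open Literature.MathematicalPhysics.QuantumFieldTheory.Balaban1983to89
open B7Prop1Explicit B7Prop2Explicit
open T4AveragingDeficitWall hiding Site Plane Plaq Bond
open T4AveragingDeficitWallBoundary (periodBox)
open AveragingDeficitPeriodicCounting (IsPeriodicDir)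
open MinimalActionSandwich (IsMinimiser)
open MinimalActionRate (Regular)
open NE3EnergyShapes (residualScale residualScale_nonneg IsUnitarySite IsPeriodicSite)
open NE3EnergyWeightedShapes (energyNormW energyNormW_nonneg)
open NE3EnergyWeightedSupShape (NE3EnergyRateWSup)
open NE3HessContinuity (bondL1At bondL1At_nonneg)
open NE3EnergySmallFieldCurl (norm_hol_vary_sub_hol_le_curl)
open NE7EtaSupFromEnergy (norm_dir_le_of_energyNormW norm_curl_le_of_energyNormW)

noncomputable section

variable {d : ℕ} {n : Type*} [Fintype n] [DecidableEq n]

/-! ## §1 Plaquette closeness from the energy norm, step-Lipschitz constants and a global sup -/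

/-- **PLAQUETTE CLOSENESS OF `W e^Z` AND `W` FROM THE ENERGY NORM.**  Unitary `W`, skew `Z` with `‖Z(b)‖ ≤ α`; `λ ≥ 0` a
step-Lipschitz constant of every `Z(·, κ)`, `λ′ ≥ 0` one of `x ↦ (d_W Z)(x; μ < ν)`; a cube `Icc y₀ (y₀ + r) ⊆ F` containing
`z`, `z + e_μ`, `z + e_ν`; `L ≥ 1`.  Then, with `E = energyNormW L k W Z F`,
`‖(W e^Z)(∂p) − W(∂p)‖ ≤ (2d·r·λ′ + E∕√((r+1)^d)) + 6(e^α − 1)·(4·(2d·r·λ + L^k·E∕√((r+1)^d)))` for `p = (z; μ < ν)`.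
(`NE3EnergySmallFieldCurl.norm_hol_vary_sub_hol_le_curl` at `t = 1` + `NE7EtaSupFromEnergy`'s two pointwise bounds.) [folklore] -/
theorem norm_fhol_vary_sub_le_of_energyNormW [Nonempty n] {L : ℕ} (hL : 1 ≤ L) (k : ℕ)
    {W : Site d → Fin d → (Matrix n n ℂ)ˣ} (hW : IsUnitaryCfg W) {Z : Site d → Fin d → Matrix n n ℂ} (hZ : IsSkewDir Z)
    {α : ℝ} (hα : ∀ x κ, ‖Z x κ‖ ≤ α) {lam lam' : ℝ} (hlam : 0 ≤ lam) (hlam' : 0 ≤ lam')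
    (hlip : ∀ (κ : Fin d) (x : Site d) (μ : Fin d), ‖Z (x + e μ) κ - Z x κ‖ ≤ lam)
    {z : Site d} {μ ν : Fin d} (hμν : μ < ν)
    (hlip' : ∀ (x : Site d) (ρ : Fin d),
      ‖curl W Z (x + e ρ, ⟨(μ, ν), hμν⟩) - curl W Z (x, ⟨(μ, ν), hμν⟩)‖ ≤ lam')
    {y₀ : Site d} {r : ℕ} {F : Finset (Site d)} (hF : Finset.Icc y₀ (y₀ + fun _ => (r : ℤ)) ⊆ F)
    (hz : z ∈ Finset.Icc y₀ (y₀ + fun _ => (r : ℤ))) (hzμ : z + e μ ∈ Finset.Icc y₀ (y₀ + fun _ => (r : ℤ)))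
    (hzν : z + e ν ∈ Finset.Icc y₀ (y₀ + fun _ => (r : ℤ))) :
    ‖((hol (vary W Z 1) z (plaqWord μ ν) : (Matrix n n ℂ)ˣ) : Matrix n n ℂ)
        - ((hol W z (plaqWord μ ν) : (Matrix n n ℂ)ˣ) : Matrix n n ℂ)‖
      ≤ (2 * d * r * lam' + energyNormW L k W Z F / Real.sqrt (((r : ℝ) + 1) ^ d))
        + 6 * (Real.exp α - 1) *
          (4 * (2 * d * r * lam + (L : ℝ) ^ k * energyNormW L k W Z F / Real.sqrt (((r : ℝ) + 1) ^ d))) := by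
  -- the NE3 crew's one-configuration calculus at t = 1
  have h0 := norm_hol_vary_sub_hol_le_curl hW hZ hα (t := (1 : ℝ)) zero_le_one z μ ν
  rw [one_mul, one_mul] at h0
  -- first order: the dressed curl at the plaquette, pointwise from the energy norm
  have h1 : ‖curlAt W Z z μ ν‖ ≤ 2 * d * r * lam' + energyNormW L k W Z F / Real.sqrt (((r : ℝ) + 1) ^ d) :=
    norm_curl_le_of_energyNormW L k W Z ⟨(μ, ν), hμν⟩ hlam' hlip' hF hz
  -- the four bonds of ∂p, pointwise from the energy norm
  set B : ℝ := 2 * d * r * lam + (L : ℝ) ^ k * energyNormW L k W Z F / Real.sqrt (((r : ℝ) + 1) ^ d) with hB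
  have hb1 : ‖Z z μ‖ ≤ B := norm_dir_le_of_energyNormW hL k W Z μ hlam (hlip μ) hF hz
  have hb2 : ‖Z (z + e μ) ν‖ ≤ B := norm_dir_le_of_energyNormW hL k W Z ν hlam (hlip ν) hF hzμ
  have hb3 : ‖Z (z + e ν) μ‖ ≤ B := norm_dir_le_of_energyNormW hL k W Z μ hlam (hlip μ) hF hzν
  have hb4 : ‖Z z ν‖ ≤ B := norm_dir_le_of_energyNormW hL k W Z ν hlam (hlip ν) hF hz
  have hL1 : bondL1At Z z μ ν ≤ 4 * B := by unfold bondL1At; linarith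
  -- the exponential factor is non-negative
  have hα0 : 0 ≤ α := (norm_nonneg _).trans (hα z μ)
  have hexp : 0 ≤ 6 * (Real.exp α - 1) := by
    have := Real.add_one_le_exp α; nlinarith
  have h2 : 6 * (Real.exp α - 1) * bondL1At Z z μ ν ≤ 6 * (Real.exp α - 1) * (4 * B) :=
    mul_le_mul_of_nonneg_left hL1 hexp
  linarith

/-! ## §2 BY NAME from row NE3's root T-E_w♯ -/

/-- **PLAQUETTE CLOSENESS OF THE TWO RUNS' BACKGROUNDS FROM T-E_w♯, CUBE SIDE FREE.**  Under `NE3EnergyRateWSup d 𝒞 L N b g C s dom`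
(`L ≥ 1`), for `k ≥ 1`, an admissible datum `V`, a run-A minimiser `UA` (level `k`), a REGULAR run-B minimiser `UB` (level `k+1`) whose
once-averaged configuration `W = rescale L (bavg L UB)` is unitary, there is the root's representation `gaugeAct u UA = vary W Z 1` with:
for every plaquette `(z; μ < ν)` whose sites `z, z + e_μ, z + e_ν` lie in a cube `Icc y₀ (y₀ + r) ⊆ periodBox (N L^k)`, and every
step-Lipschitz constants `λ` (all `Z(·, κ)`) and `λ′` (`(d_W Z)(·; μ < ν)`) the pair happens to have,
`‖(gaugeAct u UA)(∂p) − W(∂p)‖ ≤ (2d·r·λ′ + C·R_k∕√((r+1)^d)) + 6(e^{s(L⁻¹)^k} − 1)·4·(2d·r·λ + L^k·C·R_k∕√((r+1)^d))`,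
`R_k = residualScale d L N b g k`.  HONEST: T-E_w♯ is row NE3's unproved target; unitarity of `W` and the Lipschitz constants are
displayed hypotheses; the gauge `u` makes the left side the plaquette of run A's minimiser up to conjugation (gauge-invariant read-outs
are unaffected); nothing of NE3∕NE7 discharged. [folklore] -/
theorem plaquette_closeness_of_ne3EnergyRateWSup [Nonempty n] {𝒞 : ℕ → Set (Site d → Fin d → (Matrix n n ℂ)ˣ)} {L N : ℕ}
    (hL : 1 ≤ L) {b g C s : ℝ} {dom : Set (Site d → Fin d → (Matrix n n ℂ)ˣ)} (h : NE3EnergyRateWSup d 𝒞 L N b g C s dom)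
    {k : ℕ} (hk : 1 ≤ k) {V : Site d → Fin d → (Matrix n n ℂ)ˣ} (hV : V ∈ dom)
    {UA UB : Site d → Fin d → (Matrix n n ℂ)ˣ} (hA : IsMinimiser d 𝒞 L N k V UA) (hB : IsMinimiser d 𝒞 L N (k + 1) V UB)
    (hreg : Regular d L N b g (k + 1) UB) (hWu : IsUnitaryCfg (rescale L (bavg L UB))) :
    ∃ (u : Site d → (Matrix n n ℂ)ˣ) (Z : Site d → Fin d → Matrix n n ℂ),
      IsUnitarySite u ∧ IsPeriodicSite u ((N * L ^ k : ℕ) : ℤ) ∧ IsSkewDir Z ∧ IsPeriodicDir Z ((N * L ^ k : ℕ) : ℤ) ∧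
      gaugeAct u UA = vary (rescale L (bavg L UB)) Z 1 ∧
      ∀ (y₀ : Site d) (r : ℕ), Finset.Icc y₀ (y₀ + fun _ => (r : ℤ)) ⊆ periodBox (d := d) (N * L ^ k) →
        ∀ (z : Site d) (μ ν : Fin d) (hμν : μ < ν),
          z ∈ Finset.Icc y₀ (y₀ + fun _ => (r : ℤ)) → z + e μ ∈ Finset.Icc y₀ (y₀ + fun _ => (r : ℤ)) →
          z + e ν ∈ Finset.Icc y₀ (y₀ + fun _ => (r : ℤ)) →
          ∀ (lam lam' : ℝ), 0 ≤ lam → 0 ≤ lam' →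
            (∀ (κ : Fin d) (x : Site d) (ρ : Fin d), ‖Z (x + e ρ) κ - Z x κ‖ ≤ lam) →
            (∀ (x : Site d) (ρ : Fin d),
              ‖curl (rescale L (bavg L UB)) Z (x + e ρ, ⟨(μ, ν), hμν⟩) - curl (rescale L (bavg L UB)) Z (x, ⟨(μ, ν), hμν⟩)‖
                ≤ lam') →
            ‖((hol (gaugeAct u UA) z (plaqWord μ ν) : (Matrix n n ℂ)ˣ) : Matrix n n ℂ)
                - ((hol (rescale L (bavg L UB)) z (plaqWord μ ν) : (Matrix n n ℂ)ˣ) : Matrix n n ℂ)‖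
              ≤ (2 * d * r * lam' + C * residualScale d L N b g k / Real.sqrt (((r : ℝ) + 1) ^ d))
                + 6 * (Real.exp (s * ((L : ℝ)⁻¹) ^ k) - 1) *
                  (4 * (2 * d * r * lam + (L : ℝ) ^ k * (C * residualScale d L N b g k) / Real.sqrt (((r : ℝ) + 1) ^ d))) := by
  obtain ⟨u, Z, hu, huP, hZ, hZP, hrep, hE, hsup⟩ := h k hk V hV UA UB hA hB hreg
  refine ⟨u, Z, hu, huP, hZ, hZP, hrep, ?_⟩
  intro y₀ r hF z μ ν hμν hz hzμ hzν lam lam' hlam hlam' hlip hlip'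
  rw [hrep]
  set W := rescale L (bavg L UB) with hWdef
  have h1 := norm_fhol_vary_sub_le_of_energyNormW hL k hWu hZ hsup hlam hlam' hlip hμν hlip' hF hz hzμ hzν
  -- replace the energy norm by NE3's residual scale
  set E := energyNormW L k W Z (periodBox (N * L ^ k)) with hEdef
  set R := C * residualScale d L N b g k with hRdef
  have hpos : 0 < Real.sqrt (((r : ℝ) + 1) ^ d) := Real.sqrt_pos.mpr (by positivity)
  have hLk : 0 ≤ (L : ℝ) ^ k := pow_nonneg (Nat.cast_nonneg L) k
  have hER : E ≤ R := hE
  have h2 : E / Real.sqrt (((r : ℝ) + 1) ^ d) ≤ R / Real.sqrt (((r : ℝ) + 1) ^ d) := div_le_div_of_nonneg_right hER hpos.le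
  have h3 : (L : ℝ) ^ k * E / Real.sqrt (((r : ℝ) + 1) ^ d) ≤ (L : ℝ) ^ k * R / Real.sqrt (((r : ℝ) + 1) ^ d) :=
    div_le_div_of_nonneg_right (mul_le_mul_of_nonneg_left hER hLk) hpos.le
  have hα0 : 0 ≤ s * ((L : ℝ)⁻¹) ^ k := (norm_nonneg _).trans (hsup z μ)
  have hexp : 0 ≤ 6 * (Real.exp (s * ((L : ℝ)⁻¹) ^ k) - 1) := by
    have := Real.add_one_le_exp (s * ((L : ℝ)⁻¹) ^ k); nlinarith
  have h4 : 6 * (Real.exp (s * ((L : ℝ)⁻¹) ^ k) - 1) * (4 * (2 * d * r * lam + (L : ℝ) ^ k * E / Real.sqrt (((r : ℝ) + 1) ^ d)))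
      ≤ 6 * (Real.exp (s * ((L : ℝ)⁻¹) ^ k) - 1) * (4 * (2 * d * r * lam + (L : ℝ) ^ k * R / Real.sqrt (((r : ℝ) + 1) ^ d))) :=
    mul_le_mul_of_nonneg_left (by linarith) hexp
  linarith

end

end Summit.QuantumFields.BalabanUV.T4Continuum.NE7EtaPlaquetteCloseness
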